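import Summits.CriticalPhenomena.Ising3DConformalLimit.Theorems.PrecisionLaplacianMoebiusLimitOfTwoPointLawAmpLebDegenerate
import Summits.CriticalPhenomena.Ising3DConformalLimit.Theorems.PrecisionLaplacianMoebiusLimitOfTwoPointLawAmpLebMemOfInverseM
import Summits.CriticalPhenomena.Ising3DConformalLimit.Theorems.PrecisionLaplacianMoebiusLimitOfTwoPointLawAmpLebTriangleLimit
import Summits.CriticalPhenomena.Ising3DConformalLimit.Theorems.PrecisionLaplacianMoebiusLimitOfTwoPointLawAmpLebTriangleOfInverseM
import Summits.CriticalPhenomena.Ising3DConformalLimit.Theorems.PrecisionLaplacianMoebiusLimitOfTwoPointLawAmpLebImNonadj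
import HarnessLib

/-!
# Crux `PrecisionLaplacian.MoebiusLimitOfTwoPointLaw` (stmt-CriticalPhenomena-4801), line `Sketch` —
# `amputatedLebowitz_iff_inverseM`: the line's lattice input VP¹ is EQUIVALENT to the crux
# `PrecisionLaplacian.InverseMFerromagnet` (stmt-CriticalPhenomena-4798)

THEOREM-ONLY glue file (no definitions).  VP¹ ("amputated Lebowitz", registered stub
`stub_amputatedLebowitz` of line `Sketch`): for every zero-field pair ferromagnet
`gksExpect univ K C` (`K ≥ 0`, `|C i| = 2`), every site `z` and every triple `x₂ x₃ x₄`,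
`∑ₐ (Σ⁻¹)_{z a} (⟨σ_aσ_{x₂}⟩⟨σ_{x₃}σ_{x₄}⟩ + ⟨σ_aσ_{x₃}⟩⟨σ_{x₂}σ_{x₄}⟩ + ⟨σ_aσ_{x₄}⟩⟨σ_{x₂}σ_{x₃}⟩ − ⟨σ_aσ_{x₂}σ_{x₃}σ_{x₄}⟩) ≥ 0`.
IM (`InverseMFerromagnet`): every off-diagonal entry of `Σ⁻¹` is `≤ 0`.

* VP¹ ⇒ IM: `stub_inverseM_of_amputatedLebowitz` (E1 `stub_imNonadj_of_amputatedLebowitz` — one-spin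
  star–triangle decimation + one-point Schur identity — fed into the bridges C3/C4/C5 of the 4798
  chain).
* IM ⇒ VP¹ (`amputatedLebowitz_of_inverseM`, by cases): coincident triple
  (`stub_amputatedLebowitz_degenerate`), `z ∈ {x₂,x₃,x₄}` (`stub_amputatedLebowitz_mem_of_inverseM`:
  IM + GKS-II termwise), `z ∉ {x₂,x₃,x₄}` (the ghost `stub_amputatedLebowitz_triangle_of_inverseM`:
  IM at `(z, ghost)` is VP¹ with the `X`-triangle raised by `λ(ε) ↓ 0`, then continuity
  `stub_amputatedLebowitz_of_triangle_limit`).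
-/

namespace Summit.CriticalPhenomena.Ising3DConformalLimit.PrecisionLaplacianMoebiusLimitOfTwoPointLaw

open Literature.Probability.LatticeModels Finset Matrix

/-- **IM ⇒ VP¹.** The crux `InverseMFerromagnet` implies the amputated Lebowitz inequality for every
zero-field pair ferromagnet, every site and every triple (cases: coincident triple; `z` on the triple;
`z` off the triple via the ghost and the limit `t → 0⁺`). [folklore] -/
theorem amputatedLebowitz_of_inverseM :
    Summit.CriticalPhenomena.Ising3DConformalLimit.Theses.PrecisionLaplacian.InverseMFerromagnet →
    ∀ (n m : ℕ) (K : Fin m → ℝ) (C : Fin m → Finset (Fin n)), (∀ i, 0 ≤ K i) → (∀ i, (C i).card = 2) →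
      ∀ z x₂ x₃ x₄ : Fin n,
        0 ≤ ∑ a : Fin n,
          (Matrix.of fun (p q : Fin n) =>
              gksExpect Finset.univ K C (fun ω => spinAt p ω * spinAt q ω))⁻¹ z a *
            (gksExpect Finset.univ K C (fun ω => spinAt a ω * spinAt x₂ ω) *
                gksExpect Finset.univ K C (fun ω => spinAt x₃ ω * spinAt x₄ ω) +
              gksExpect Finset.univ K C (fun ω => spinAt a ω * spinAt x₃ ω) *
                gksExpect Finset.univ K C (fun ω => spinAt x₂ ω * spinAt x₄ ω) +
              gksExpect Finset.univ K C (fun ω => spinAt a ω * spinAt x₄ ω) *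
                gksExpect Finset.univ K C (fun ω => spinAt x₂ ω * spinAt x₃ ω) -
              gksExpect Finset.univ K C
                (fun ω => spinAt a ω * spinAt x₂ ω * spinAt x₃ ω * spinAt x₄ ω)) := by
  intro hIM n m K C hK hC z x₂ x₃ x₄
  by_cases hd : x₂ ≠ x₃ ∧ x₂ ≠ x₄ ∧ x₃ ≠ x₄
  · by_cases hz : z = x₂ ∨ z = x₃ ∨ z = x₄
    · exact stub_amputatedLebowitz_mem_of_inverseM hIM n m K C hK hC z x₂ x₃ x₄ hd hz
    · exact stub_amputatedLebowitz_of_triangle_limit n m K C z x₂ x₃ x₄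
        (fun ε hε => stub_amputatedLebowitz_triangle_of_inverseM hIM n m K C hK hC z x₂ x₃ x₄ hd hz ε hε)
  · exact stub_amputatedLebowitz_degenerate n m K C hK hC z x₂ x₃ x₄ hd

/-- Registered sub-goal `amputatedLebowitz_iff_inverseM` of line `Sketch` (lead c18): **VP¹ ≡ IM** — the
line's lattice input `stub_amputatedLebowitz` (one-leg precision amputation of `U₄` keeps the Lebowitz
sign, for every finite zero-field pair ferromagnet) is EQUIVALENT to the crux
`PrecisionLaplacian.InverseMFerromagnet` (stmt-CriticalPhenomena-4798, the Lauritzen–Uhler–Zwiernik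
inverse-M-matrix statement).  `→`: `stub_inverseM_of_amputatedLebowitz`; `←`:
`amputatedLebowitz_of_inverseM`. [folklore] -/
theorem amputatedLebowitz_iff_inverseM :
    (∀ (n m : ℕ) (K : Fin m → ℝ) (C : Fin m → Finset (Fin n)), (∀ i, 0 ≤ K i) → (∀ i, (C i).card = 2) →
      ∀ z x₂ x₃ x₄ : Fin n,
        0 ≤ ∑ a : Fin n,
          (Matrix.of fun (p q : Fin n) =>
              gksExpect Finset.univ K C (fun ω => spinAt p ω * spinAt q ω))⁻¹ z a *
            (gksExpect Finset.univ K C (fun ω => spinAt a ω * spinAt x₂ ω) *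
                gksExpect Finset.univ K C (fun ω => spinAt x₃ ω * spinAt x₄ ω) +
              gksExpect Finset.univ K C (fun ω => spinAt a ω * spinAt x₃ ω) *
                gksExpect Finset.univ K C (fun ω => spinAt x₂ ω * spinAt x₄ ω) +
              gksExpect Finset.univ K C (fun ω => spinAt a ω * spinAt x₄ ω) *
                gksExpect Finset.univ K C (fun ω => spinAt x₂ ω * spinAt x₃ ω) -
              gksExpect Finset.univ K C
                (fun ω => spinAt a ω * spinAt x₂ ω * spinAt x₃ ω * spinAt x₄ ω))) ↔
    Summit.CriticalPhenomena.Ising3DConformalLimit.Theses.PrecisionLaplacian.InverseMFerromagnet :=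
  ⟨stub_inverseM_of_amputatedLebowitz, amputatedLebowitz_of_inverseM⟩

end Summit.CriticalPhenomena.Ising3DConformalLimit.PrecisionLaplacianMoebiusLimitOfTwoPointLaw
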